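import Mathlib
import HarnessLib
import Summits.PneNP.PneNP.Theorems.CnfIdealGenLengthRankDefectRepresentationsCutLemmaMaxCut

/-!
# Crux `RankDefectRepresentations` (stmt-PneNP-18923), line `rank-dehn-ladder`: BAND AVERAGING
# (lead g16 RESHAPE 16, tool stub X2 `stub_bandAveraging`; briefs `Cruxes/RankDefectRepresentations/Lines/rank-dehn-ladder-briefs-g16e.md` §X2)

Setting (two-family instances).  Rows `x : ι` of a matrix `D : Matrix ι ι' K` carry two colours `rI x : X`, `rJ x : Y`, columns
`y : ι'` carry `cI y : X`, `cJ y : Y` (`X`, `Y` finite).  For a DOUBLE CUT `(A, A')`, `A : Finset X`, `A' : Finset Y`, the RECTANGLE is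
`R(A, A') := D ∘ 1[(rI ∈ A ∧ rJ ∈ A') × (cI ∉ A ∧ cJ ∉ A')]` (as a zero-padded `ι × ι'` matrix).

THE THREE ERROR FAMILIES of the band completion (X1, `stub_bandCompletion`) at the cut `(A, A')` are PRIVATE DIMENSIONS of column
classes of rectangles at SHIFTED cuts: for `i ∈ A` the I-strip error `rank R(A∖i, A') − rank (R(A∖i, A') with the column class cI = i
removed)`, for `j ∈ A'` the J-strip error (symmetric), and for `(i, j) ∈ A × A'` the class error `rank R(A∖i, A'∖j) − rank (R(A∖i, A'∖j)
with the column class (cI, cJ) = (i, j) removed)`.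

THEOREM (`stub_bandAveraging`, the registered signature verbatim): summed over ALL double cuts `(A, A')`, the three error families
total at most `3 · Σ_{(A,A')} rank R(A, A')`.

PROOF (brief §X2).  (1) RE-INDEXING (`sum_sum_erase_eq`): for each fixed colour `i`, `A ↦ A.erase i` is a bijection from the cuts
containing `i` onto the cuts avoiding `i` (inverse `insert i`), so `Σ_A Σ_{i∈A} g (A.erase i) i = Σ_S Σ_{i∈Sᶜ} g S i`; we prove it by
splitting `Finset (Finset X) = 𝒫(insert i (univ ∖ i))` with `Finset.sum_powerset_insert`.  After re-indexing, each family is a sum over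
cuts `(S, S')` of `Σ_{classes} (rank R(S,S') − rank R(S,S')^{−class})`.  (2) PRIVATE DIMENSIONS ADD UP (`sum_rank_sub_colClass_le`,
the column version of p642504's `…CutLemmaMaxCut.sum_rank_sub_erase_le`, obtained on the transpose): for any matrix `M`, any column
colouring and any set `C` of colours, `Σ_{q∈C} (rank M − rank M^{−q}) ≤ rank M`.  (3) Sum the three pointwise bounds over all cuts.
Elementary linear algebra over `ℤ`-casts; Mathlib + p642504 only.

HONEST FRAMING: a negative-lane TOOL of the line (one half of the 2D average-cut theorem; the lead assembles `DoubleMaxCutFour`);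
it closes no rung by itself; the item (RDR) stays open; P ≠ NP is not moved; F-N2 is a FRONTIER formal rung.
-/

set_option linter.dupNamespace false -- `Summit.PneNP.PneNP.…`: summit = sub-problem name (D-0017)

namespace Summit.PneNP.PneNP.Theorems.CnfIdealGenLengthRankDefectRepresentationsBandAveraging

open Finset Matrix
open Summit.PneNP.PneNP.Theorems.CnfIdealGenLengthRankDefectRepresentationsCutLemmaMaxCut (sum_rank_sub_erase_le)

section Reindex

variable {X : Type} [Fintype X] [DecidableEq X] {M : Type} [AddCommMonoid M]

/-- Re-indexing at a fixed colour `i`: summing `g (A.erase i) i` over the sets `A ∋ i` is summing `g S i` over the sets `S ∌ i`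
(`A ↦ A.erase i` is a bijection with inverse `insert i`), written with indicators over all of `Finset X`. [folklore] -/
theorem sum_ite_mem_erase_eq (g : Finset X → X → M) (i : X) :
    ∑ A : Finset X, (if i ∈ A then g (A.erase i) i else 0) =
      ∑ S : Finset X, (if i ∈ Sᶜ then g S i else 0) := by
  have hi : i ∉ (Finset.univ : Finset X).erase i := Finset.notMem_erase i _
  have hu : (Finset.univ : Finset (Finset X)) = (insert i ((Finset.univ : Finset X).erase i)).powerset := by
    rw [Finset.insert_erase (Finset.mem_univ i), Finset.powerset_univ]
  have h1 : ∀ t ∈ ((Finset.univ : Finset X).erase i).powerset, (if i ∈ t then g (t.erase i) i else 0) = 0 := by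
    intro t ht
    rw [if_neg (fun h => hi (Finset.mem_powerset.mp ht h))]
  have h2 : ∀ t ∈ ((Finset.univ : Finset X).erase i).powerset,
      (if i ∈ insert i t then g ((insert i t).erase i) i else 0) = g t i := by
    intro t ht
    rw [if_pos (Finset.mem_insert_self i t), Finset.erase_insert (fun h => hi (Finset.mem_powerset.mp ht h))]
  have h3 : ∀ t ∈ ((Finset.univ : Finset X).erase i).powerset, (if i ∈ tᶜ then g t i else 0) = g t i := by
    intro t ht
    rw [if_pos (Finset.mem_compl.mpr (fun h => hi (Finset.mem_powerset.mp ht h)))]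
  have h4 : ∀ t ∈ ((Finset.univ : Finset X).erase i).powerset,
      (if i ∈ (insert i t)ᶜ then g (insert i t) i else 0) = 0 := by
    intro t _
    rw [if_neg (fun h => Finset.mem_compl.mp h (Finset.mem_insert_self i t))]
  rw [hu, Finset.sum_powerset_insert hi, Finset.sum_powerset_insert hi]
  rw [Finset.sum_congr rfl h1, Finset.sum_congr rfl h2, Finset.sum_congr rfl h3, Finset.sum_congr rfl h4,
    Finset.sum_const_zero, zero_add, add_zero]

/-- RE-INDEXING `A ↦ A.erase i`: `Σ_A Σ_{i ∈ A} g (A.erase i) i = Σ_S Σ_{i ∉ S} g S i` over all finite sets of a finite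
type (for each `i`, erasing `i` is a bijection from the sets containing `i` onto the sets avoiding it). [folklore] -/
theorem sum_sum_erase_eq (g : Finset X → X → M) :
    ∑ A : Finset X, ∑ i ∈ A, g (A.erase i) i = ∑ S : Finset X, ∑ i ∈ Sᶜ, g S i := by
  calc ∑ A : Finset X, ∑ i ∈ A, g (A.erase i) i
      = ∑ A : Finset X, ∑ i : X, (if i ∈ A then g (A.erase i) i else 0) :=
        Finset.sum_congr rfl fun A _ => (Finset.sum_ite_mem_eq A fun i => g (A.erase i) i).symm
    _ = ∑ i : X, ∑ A : Finset X, (if i ∈ A then g (A.erase i) i else 0) := Finset.sum_comm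
    _ = ∑ i : X, ∑ S : Finset X, (if i ∈ Sᶜ then g S i else 0) :=
        Finset.sum_congr rfl fun i _ => sum_ite_mem_erase_eq g i
    _ = ∑ S : Finset X, ∑ i : X, (if i ∈ Sᶜ then g S i else 0) := Finset.sum_comm
    _ = ∑ S : Finset X, ∑ i ∈ Sᶜ, g S i :=
        Finset.sum_congr rfl fun S _ => Finset.sum_ite_mem_eq Sᶜ fun i => g S i

end Reindex

section PrivateDimensions

variable {K : Type} [Field K] {ι ι' Q : Type} [Fintype ι] [Fintype ι'] [Fintype Q] [DecidableEq Q]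

/-- **Private dimensions of column classes add up below the rank.**  For a column colouring `col`, a matrix `M` and any set `C`
of colours, `Σ_{q ∈ C} (rank M − rank M^{−q}) ≤ rank M`, where `M^{−q}` is `M` with the columns of colour `q` zeroed.  (Column
version of `…CutLemmaMaxCut.sum_rank_sub_erase_le`, applied to `Mᵀ` with the full colour set.) [folklore] -/
theorem sum_rank_sub_colClass_le (col : ι' → Q) (M : Matrix ι ι' K) (C : Finset Q) :
    ∑ q ∈ C, ((M.rank : ℤ) - ((Matrix.of fun x y => if col y = q then 0 else M x y).rank : ℤ)) ≤ (M.rank : ℤ) := by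
  classical
  have main := sum_rank_sub_erase_le (K := K) col M.transpose Finset.univ C
  have e1 : (Matrix.of fun z x => if col z ∈ (Finset.univ : Finset Q) then M.transpose z x else 0) = M.transpose := by
    ext z x; simp
  have e2 : ∀ q, (Matrix.of fun z x => if col z ∈ (Finset.univ : Finset Q).erase q then M.transpose z x else 0) =
      (Matrix.of fun x y => if col y = q then 0 else M x y).transpose := by
    intro q; ext z x
    simp only [Matrix.of_apply, Matrix.transpose_apply, Finset.mem_erase, Finset.mem_univ, and_true]
    by_cases h : col z = q <;> simp [h]
  simp only [e1, e2, Matrix.rank_transpose] at main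
  have hz : (0 : ℤ) ≤ ((Matrix.of fun z x => if col z ∈ (Finset.univ : Finset Q) \ C then M.transpose z x else 0).rank : ℤ) := by
    positivity
  linarith

end PrivateDimensions

section Families

variable {K : Type} [Field K] {ι ι' X Y : Type} [Fintype ι] [Fintype ι'] [Fintype X] [DecidableEq X] [Fintype Y] [DecidableEq Y]
  (rI : ι → X) (rJ : ι → Y) (cI : ι' → X) (cJ : ι' → Y) (D : Matrix ι ι' K)

/-- FIRST FAMILY (I-strips): summed over all double cuts, the private dimensions of the column classes `cI = i`, `i ∈ A`, of the
rectangles `R(A∖i, A')` total at most `Σ_{(A,A')} rank R(A, A')` (re-index `A ↦ A.erase i`, then private dimensions add up). -/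
theorem sum_familyI_le :
    ∑ A : Finset X, ∑ A' : Finset Y, ∑ i ∈ A,
        (((Matrix.of fun x y => if (rI x ∈ A.erase i ∧ rJ x ∈ A') ∧ (cI y ∉ A.erase i ∧ cJ y ∉ A') then D x y else 0).rank : ℤ) -
         ((Matrix.of fun x y => if (rI x ∈ A.erase i ∧ rJ x ∈ A') ∧ (cI y ∉ A ∧ cJ y ∉ A') then D x y else 0).rank : ℤ)) ≤
      ∑ A : Finset X, ∑ A' : Finset Y,
        ((Matrix.of fun x y => if (rI x ∈ A ∧ rJ x ∈ A') ∧ (cI y ∉ A ∧ cJ y ∉ A') then D x y else 0).rank : ℤ) := by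
  -- (1) the subtracted matrix is the rectangle `R(A∖i, A')` with the column class `cI = i` zeroed (uses `i ∈ A`)
  have step1 : ∀ (A : Finset X) (A' : Finset Y), ∀ i ∈ A,
      (Matrix.of fun x y => if (rI x ∈ A.erase i ∧ rJ x ∈ A') ∧ (cI y ∉ A ∧ cJ y ∉ A') then D x y else 0) =
      Matrix.of fun x y => if cI y = i then 0 else
        (Matrix.of fun x y => if (rI x ∈ A.erase i ∧ rJ x ∈ A') ∧ (cI y ∉ A.erase i ∧ cJ y ∉ A') then D x y else (0 : K)) x y := by
    intro A A' i hi
    ext x y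
    by_cases h : cI y = i
    · subst h; simp [hi]
    · simp [Matrix.of_apply, Finset.mem_erase, h]
  calc ∑ A : Finset X, ∑ A' : Finset Y, ∑ i ∈ A,
        (((Matrix.of fun x y => if (rI x ∈ A.erase i ∧ rJ x ∈ A') ∧ (cI y ∉ A.erase i ∧ cJ y ∉ A') then D x y else 0).rank : ℤ) -
         ((Matrix.of fun x y => if (rI x ∈ A.erase i ∧ rJ x ∈ A') ∧ (cI y ∉ A ∧ cJ y ∉ A') then D x y else 0).rank : ℤ))
      = ∑ A : Finset X, ∑ A' : Finset Y, ∑ i ∈ A,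
        (((Matrix.of fun x y => if (rI x ∈ A.erase i ∧ rJ x ∈ A') ∧ (cI y ∉ A.erase i ∧ cJ y ∉ A') then D x y else 0).rank : ℤ) -
         ((Matrix.of fun x y => if cI y = i then 0 else
            (Matrix.of fun x y => if (rI x ∈ A.erase i ∧ rJ x ∈ A') ∧ (cI y ∉ A.erase i ∧ cJ y ∉ A') then D x y else (0 : K))
              x y).rank : ℤ)) := by
        refine Finset.sum_congr rfl fun A _ => Finset.sum_congr rfl fun A' _ => Finset.sum_congr rfl fun i hi => ?_
        rw [step1 A A' i hi]
    _ = ∑ A' : Finset Y, ∑ A : Finset X, ∑ i ∈ A,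
        (((Matrix.of fun x y => if (rI x ∈ A.erase i ∧ rJ x ∈ A') ∧ (cI y ∉ A.erase i ∧ cJ y ∉ A') then D x y else 0).rank : ℤ) -
         ((Matrix.of fun x y => if cI y = i then 0 else
            (Matrix.of fun x y => if (rI x ∈ A.erase i ∧ rJ x ∈ A') ∧ (cI y ∉ A.erase i ∧ cJ y ∉ A') then D x y else (0 : K))
              x y).rank : ℤ)) := Finset.sum_comm
    _ = ∑ A' : Finset Y, ∑ S : Finset X, ∑ i ∈ Sᶜ,
        (((Matrix.of fun x y => if (rI x ∈ S ∧ rJ x ∈ A') ∧ (cI y ∉ S ∧ cJ y ∉ A') then D x y else 0).rank : ℤ) -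
         ((Matrix.of fun x y => if cI y = i then 0 else
            (Matrix.of fun x y => if (rI x ∈ S ∧ rJ x ∈ A') ∧ (cI y ∉ S ∧ cJ y ∉ A') then D x y else (0 : K)) x y).rank : ℤ)) :=
        Finset.sum_congr rfl fun A' _ => sum_sum_erase_eq (fun T i =>
          (((Matrix.of fun x y => if (rI x ∈ T ∧ rJ x ∈ A') ∧ (cI y ∉ T ∧ cJ y ∉ A') then D x y else 0).rank : ℤ) -
           ((Matrix.of fun x y => if cI y = i then 0 else
              (Matrix.of fun x y => if (rI x ∈ T ∧ rJ x ∈ A') ∧ (cI y ∉ T ∧ cJ y ∉ A') then D x y else (0 : K)) x y).rank : ℤ)))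
    _ = ∑ S : Finset X, ∑ A' : Finset Y, ∑ i ∈ Sᶜ,
        (((Matrix.of fun x y => if (rI x ∈ S ∧ rJ x ∈ A') ∧ (cI y ∉ S ∧ cJ y ∉ A') then D x y else 0).rank : ℤ) -
         ((Matrix.of fun x y => if cI y = i then 0 else
            (Matrix.of fun x y => if (rI x ∈ S ∧ rJ x ∈ A') ∧ (cI y ∉ S ∧ cJ y ∉ A') then D x y else (0 : K)) x y).rank : ℤ)) :=
        Finset.sum_comm
    _ ≤ ∑ S : Finset X, ∑ A' : Finset Y,
        ((Matrix.of fun x y => if (rI x ∈ S ∧ rJ x ∈ A') ∧ (cI y ∉ S ∧ cJ y ∉ A') then D x y else 0).rank : ℤ) :=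
        Finset.sum_le_sum fun S _ => Finset.sum_le_sum fun A' _ => sum_rank_sub_colClass_le cI _ Sᶜ

/-- SECOND FAMILY (J-strips): the mirror image of `sum_familyI_le` in the second colour (re-index `A' ↦ A'.erase j`). -/
theorem sum_familyJ_le :
    ∑ A : Finset X, ∑ A' : Finset Y, ∑ j ∈ A',
        (((Matrix.of fun x y => if (rI x ∈ A ∧ rJ x ∈ A'.erase j) ∧ (cI y ∉ A ∧ cJ y ∉ A'.erase j) then D x y else 0).rank : ℤ) -
         ((Matrix.of fun x y => if (rI x ∈ A ∧ rJ x ∈ A'.erase j) ∧ (cI y ∉ A ∧ cJ y ∉ A') then D x y else 0).rank : ℤ)) ≤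
      ∑ A : Finset X, ∑ A' : Finset Y,
        ((Matrix.of fun x y => if (rI x ∈ A ∧ rJ x ∈ A') ∧ (cI y ∉ A ∧ cJ y ∉ A') then D x y else 0).rank : ℤ) := by
  -- (1) the subtracted matrix is the rectangle `R(A, A'∖j)` with the column class `cJ = j` zeroed (uses `j ∈ A'`)
  have step1 : ∀ (A : Finset X) (A' : Finset Y), ∀ j ∈ A',
      (Matrix.of fun x y => if (rI x ∈ A ∧ rJ x ∈ A'.erase j) ∧ (cI y ∉ A ∧ cJ y ∉ A') then D x y else 0) =
      Matrix.of fun x y => if cJ y = j then 0 else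
        (Matrix.of fun x y => if (rI x ∈ A ∧ rJ x ∈ A'.erase j) ∧ (cI y ∉ A ∧ cJ y ∉ A'.erase j) then D x y else (0 : K)) x y := by
    intro A A' j hj
    ext x y
    by_cases h : cJ y = j
    · subst h; simp [hj]
    · simp [Matrix.of_apply, Finset.mem_erase, h]
  calc ∑ A : Finset X, ∑ A' : Finset Y, ∑ j ∈ A',
        (((Matrix.of fun x y => if (rI x ∈ A ∧ rJ x ∈ A'.erase j) ∧ (cI y ∉ A ∧ cJ y ∉ A'.erase j) then D x y else 0).rank : ℤ) -
         ((Matrix.of fun x y => if (rI x ∈ A ∧ rJ x ∈ A'.erase j) ∧ (cI y ∉ A ∧ cJ y ∉ A') then D x y else 0).rank : ℤ))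
      = ∑ A : Finset X, ∑ A' : Finset Y, ∑ j ∈ A',
        (((Matrix.of fun x y => if (rI x ∈ A ∧ rJ x ∈ A'.erase j) ∧ (cI y ∉ A ∧ cJ y ∉ A'.erase j) then D x y else 0).rank : ℤ) -
         ((Matrix.of fun x y => if cJ y = j then 0 else
            (Matrix.of fun x y => if (rI x ∈ A ∧ rJ x ∈ A'.erase j) ∧ (cI y ∉ A ∧ cJ y ∉ A'.erase j) then D x y else (0 : K))
              x y).rank : ℤ)) := by
        refine Finset.sum_congr rfl fun A _ => Finset.sum_congr rfl fun A' _ => Finset.sum_congr rfl fun j hj => ?_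
        rw [step1 A A' j hj]
    _ = ∑ A : Finset X, ∑ S' : Finset Y, ∑ j ∈ S'ᶜ,
        (((Matrix.of fun x y => if (rI x ∈ A ∧ rJ x ∈ S') ∧ (cI y ∉ A ∧ cJ y ∉ S') then D x y else 0).rank : ℤ) -
         ((Matrix.of fun x y => if cJ y = j then 0 else
            (Matrix.of fun x y => if (rI x ∈ A ∧ rJ x ∈ S') ∧ (cI y ∉ A ∧ cJ y ∉ S') then D x y else (0 : K)) x y).rank : ℤ)) :=
        Finset.sum_congr rfl fun A _ => sum_sum_erase_eq (fun T' j =>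
          (((Matrix.of fun x y => if (rI x ∈ A ∧ rJ x ∈ T') ∧ (cI y ∉ A ∧ cJ y ∉ T') then D x y else 0).rank : ℤ) -
           ((Matrix.of fun x y => if cJ y = j then 0 else
              (Matrix.of fun x y => if (rI x ∈ A ∧ rJ x ∈ T') ∧ (cI y ∉ A ∧ cJ y ∉ T') then D x y else (0 : K)) x y).rank : ℤ)))
    _ ≤ ∑ A : Finset X, ∑ S' : Finset Y,
        ((Matrix.of fun x y => if (rI x ∈ A ∧ rJ x ∈ S') ∧ (cI y ∉ A ∧ cJ y ∉ S') then D x y else 0).rank : ℤ) :=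
        Finset.sum_le_sum fun A _ => Finset.sum_le_sum fun S' _ => sum_rank_sub_colClass_le cJ _ S'ᶜ

/-- THIRD FAMILY (classes): summed over all double cuts, the private dimensions of the column classes `(cI, cJ) = (i, j)`,
`(i, j) ∈ A × A'`, of the rectangles `R(A∖i, A'∖j)` total at most `Σ_{(A,A')} rank R(A, A')` (re-index in both colours, then the
private dimensions of the pair-coloured column classes add up). -/
theorem sum_familyIJ_le :
    ∑ A : Finset X, ∑ A' : Finset Y, ∑ i ∈ A, ∑ j ∈ A',
        (((Matrix.of fun x y => if (rI x ∈ A.erase i ∧ rJ x ∈ A'.erase j) ∧ (cI y ∉ A.erase i ∧ cJ y ∉ A'.erase j)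
            then D x y else 0).rank : ℤ) -
         ((Matrix.of fun x y => if (rI x ∈ A.erase i ∧ rJ x ∈ A'.erase j) ∧ (cI y ∉ A.erase i ∧ cJ y ∉ A'.erase j) ∧
              ¬ (cI y = i ∧ cJ y = j) then D x y else 0).rank : ℤ)) ≤
      ∑ A : Finset X, ∑ A' : Finset Y,
        ((Matrix.of fun x y => if (rI x ∈ A ∧ rJ x ∈ A') ∧ (cI y ∉ A ∧ cJ y ∉ A') then D x y else 0).rank : ℤ) := by
  -- (1) the subtracted matrix is the rectangle `R(S, S')` with the column class `(cI, cJ) = (i, j)` zeroed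
  have step1 : ∀ (S : Finset X) (S' : Finset Y) (i : X) (j : Y),
      (Matrix.of fun x y => if (rI x ∈ S ∧ rJ x ∈ S') ∧ (cI y ∉ S ∧ cJ y ∉ S') ∧ ¬ (cI y = i ∧ cJ y = j) then D x y else 0) =
      Matrix.of fun x y => if (cI y, cJ y) = (i, j) then 0 else
        (Matrix.of fun x y => if (rI x ∈ S ∧ rJ x ∈ S') ∧ (cI y ∉ S ∧ cJ y ∉ S') then D x y else (0 : K)) x y := by
    intro S S' i j
    ext x y
    by_cases h1 : cI y = i <;> by_cases h2 : cJ y = j <;> simp [Matrix.of_apply, h1, h2]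
  -- (2) pointwise: private dimensions of the pair-coloured column classes of `R(S, S')`
  have step2 : ∀ (S : Finset X) (S' : Finset Y),
      ∑ i ∈ Sᶜ, ∑ j ∈ S'ᶜ,
        (((Matrix.of fun x y => if (rI x ∈ S ∧ rJ x ∈ S') ∧ (cI y ∉ S ∧ cJ y ∉ S') then D x y else 0).rank : ℤ) -
         ((Matrix.of fun x y => if (cI y, cJ y) = (i, j) then 0 else
            (Matrix.of fun x y => if (rI x ∈ S ∧ rJ x ∈ S') ∧ (cI y ∉ S ∧ cJ y ∉ S') then D x y else (0 : K)) x y).rank : ℤ)) ≤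
      ((Matrix.of fun x y => if (rI x ∈ S ∧ rJ x ∈ S') ∧ (cI y ∉ S ∧ cJ y ∉ S') then D x y else 0).rank : ℤ) := by
    intro S S'
    rw [← Finset.sum_product' Sᶜ S'ᶜ (fun i j =>
      (((Matrix.of fun x y => if (rI x ∈ S ∧ rJ x ∈ S') ∧ (cI y ∉ S ∧ cJ y ∉ S') then D x y else 0).rank : ℤ) -
       ((Matrix.of fun x y => if (cI y, cJ y) = (i, j) then 0 else
          (Matrix.of fun x y => if (rI x ∈ S ∧ rJ x ∈ S') ∧ (cI y ∉ S ∧ cJ y ∉ S') then D x y else (0 : K)) x y).rank : ℤ)))]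
    exact sum_rank_sub_colClass_le (fun y => (cI y, cJ y)) _ (Sᶜ ×ˢ S'ᶜ)
  calc ∑ A : Finset X, ∑ A' : Finset Y, ∑ i ∈ A, ∑ j ∈ A',
        (((Matrix.of fun x y => if (rI x ∈ A.erase i ∧ rJ x ∈ A'.erase j) ∧ (cI y ∉ A.erase i ∧ cJ y ∉ A'.erase j)
            then D x y else 0).rank : ℤ) -
         ((Matrix.of fun x y => if (rI x ∈ A.erase i ∧ rJ x ∈ A'.erase j) ∧ (cI y ∉ A.erase i ∧ cJ y ∉ A'.erase j) ∧
              ¬ (cI y = i ∧ cJ y = j) then D x y else 0).rank : ℤ))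
      = ∑ A : Finset X, ∑ A' : Finset Y, ∑ i ∈ A, ∑ j ∈ A',
        (((Matrix.of fun x y => if (rI x ∈ A.erase i ∧ rJ x ∈ A'.erase j) ∧ (cI y ∉ A.erase i ∧ cJ y ∉ A'.erase j)
            then D x y else 0).rank : ℤ) -
         ((Matrix.of fun x y => if (cI y, cJ y) = (i, j) then 0 else
            (Matrix.of fun x y => if (rI x ∈ A.erase i ∧ rJ x ∈ A'.erase j) ∧ (cI y ∉ A.erase i ∧ cJ y ∉ A'.erase j)
              then D x y else (0 : K)) x y).rank : ℤ)) := by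
        refine Finset.sum_congr rfl fun A _ => Finset.sum_congr rfl fun A' _ =>
          Finset.sum_congr rfl fun i _ => Finset.sum_congr rfl fun j _ => ?_
        rw [step1 (A.erase i) (A'.erase j) i j]
    _ = ∑ A : Finset X, ∑ i ∈ A, ∑ A' : Finset Y, ∑ j ∈ A',
        (((Matrix.of fun x y => if (rI x ∈ A.erase i ∧ rJ x ∈ A'.erase j) ∧ (cI y ∉ A.erase i ∧ cJ y ∉ A'.erase j)
            then D x y else 0).rank : ℤ) -
         ((Matrix.of fun x y => if (cI y, cJ y) = (i, j) then 0 else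
            (Matrix.of fun x y => if (rI x ∈ A.erase i ∧ rJ x ∈ A'.erase j) ∧ (cI y ∉ A.erase i ∧ cJ y ∉ A'.erase j)
              then D x y else (0 : K)) x y).rank : ℤ)) :=
        Finset.sum_congr rfl fun A _ => Finset.sum_comm
    _ = ∑ A : Finset X, ∑ i ∈ A, ∑ S' : Finset Y, ∑ j ∈ S'ᶜ,
        (((Matrix.of fun x y => if (rI x ∈ A.erase i ∧ rJ x ∈ S') ∧ (cI y ∉ A.erase i ∧ cJ y ∉ S')
            then D x y else 0).rank : ℤ) -
         ((Matrix.of fun x y => if (cI y, cJ y) = (i, j) then 0 else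
            (Matrix.of fun x y => if (rI x ∈ A.erase i ∧ rJ x ∈ S') ∧ (cI y ∉ A.erase i ∧ cJ y ∉ S')
              then D x y else (0 : K)) x y).rank : ℤ)) :=
        Finset.sum_congr rfl fun A _ => Finset.sum_congr rfl fun i _ => sum_sum_erase_eq (fun T' j =>
          (((Matrix.of fun x y => if (rI x ∈ A.erase i ∧ rJ x ∈ T') ∧ (cI y ∉ A.erase i ∧ cJ y ∉ T')
              then D x y else 0).rank : ℤ) -
           ((Matrix.of fun x y => if (cI y, cJ y) = (i, j) then 0 else
              (Matrix.of fun x y => if (rI x ∈ A.erase i ∧ rJ x ∈ T') ∧ (cI y ∉ A.erase i ∧ cJ y ∉ T')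
                then D x y else (0 : K)) x y).rank : ℤ)))
    _ = ∑ S : Finset X, ∑ i ∈ Sᶜ, ∑ S' : Finset Y, ∑ j ∈ S'ᶜ,
        (((Matrix.of fun x y => if (rI x ∈ S ∧ rJ x ∈ S') ∧ (cI y ∉ S ∧ cJ y ∉ S') then D x y else 0).rank : ℤ) -
         ((Matrix.of fun x y => if (cI y, cJ y) = (i, j) then 0 else
            (Matrix.of fun x y => if (rI x ∈ S ∧ rJ x ∈ S') ∧ (cI y ∉ S ∧ cJ y ∉ S') then D x y else (0 : K)) x y).rank : ℤ)) :=
        sum_sum_erase_eq (fun T i => ∑ S' : Finset Y, ∑ j ∈ S'ᶜ,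
          ((((Matrix.of fun x y => if (rI x ∈ T ∧ rJ x ∈ S') ∧ (cI y ∉ T ∧ cJ y ∉ S') then D x y else 0).rank : ℤ) -
           ((Matrix.of fun x y => if (cI y, cJ y) = (i, j) then 0 else
              (Matrix.of fun x y => if (rI x ∈ T ∧ rJ x ∈ S') ∧ (cI y ∉ T ∧ cJ y ∉ S') then D x y else (0 : K)) x y).rank : ℤ))))
    _ = ∑ S : Finset X, ∑ S' : Finset Y, ∑ i ∈ Sᶜ, ∑ j ∈ S'ᶜ,
        (((Matrix.of fun x y => if (rI x ∈ S ∧ rJ x ∈ S') ∧ (cI y ∉ S ∧ cJ y ∉ S') then D x y else 0).rank : ℤ) -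
         ((Matrix.of fun x y => if (cI y, cJ y) = (i, j) then 0 else
            (Matrix.of fun x y => if (rI x ∈ S ∧ rJ x ∈ S') ∧ (cI y ∉ S ∧ cJ y ∉ S') then D x y else (0 : K)) x y).rank : ℤ)) :=
        Finset.sum_congr rfl fun S _ => Finset.sum_comm
    _ ≤ ∑ S : Finset X, ∑ S' : Finset Y,
        ((Matrix.of fun x y => if (rI x ∈ S ∧ rJ x ∈ S') ∧ (cI y ∉ S ∧ cJ y ∉ S') then D x y else 0).rank : ℤ) :=
        Finset.sum_le_sum fun S _ => Finset.sum_le_sum fun S' _ => step2 S S'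

end Families

/-- **Band averaging** (registered stub `stub_bandAveraging`, X2 of RESHAPE 16, signature verbatim): summed over all double cuts
`(A, A')`, the three error families of the band completion — the private dimensions of the I-strip classes of `R(A∖i, A')`, of the
J-strip classes of `R(A, A'∖j)`, and of the pair classes of `R(A∖i, A'∖j)` — total at most `3 · Σ_{(A,A')} rank R(A, A')`.
Proof: `sum_familyI_le + sum_familyJ_le + sum_familyIJ_le`. -/
theorem stub_bandAveraging :
    ∀ (K : Type) [Field K] (ι ι' X Y : Type) [Fintype ι] [Fintype ι'] [DecidableEq ι] [DecidableEq ι'] [Fintype X] [DecidableEq X]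
      [Fintype Y] [DecidableEq Y] (rI : ι → X) (rJ : ι → Y) (cI : ι' → X) (cJ : ι' → Y) (D : Matrix ι ι' K),
      ∑ A : Finset X, ∑ A' : Finset Y,
        (∑ i ∈ A,
            (((Matrix.of fun x y => if (rI x ∈ A.erase i ∧ rJ x ∈ A') ∧ (cI y ∉ A.erase i ∧ cJ y ∉ A') then D x y else 0).rank : ℤ) -
             ((Matrix.of fun x y => if (rI x ∈ A.erase i ∧ rJ x ∈ A') ∧ (cI y ∉ A ∧ cJ y ∉ A') then D x y else 0).rank : ℤ)) +
          ∑ j ∈ A',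
            (((Matrix.of fun x y => if (rI x ∈ A ∧ rJ x ∈ A'.erase j) ∧ (cI y ∉ A ∧ cJ y ∉ A'.erase j) then D x y else 0).rank : ℤ) -
             ((Matrix.of fun x y => if (rI x ∈ A ∧ rJ x ∈ A'.erase j) ∧ (cI y ∉ A ∧ cJ y ∉ A') then D x y else 0).rank : ℤ)) +
          ∑ i ∈ A, ∑ j ∈ A',
            (((Matrix.of fun x y => if (rI x ∈ A.erase i ∧ rJ x ∈ A'.erase j) ∧ (cI y ∉ A.erase i ∧ cJ y ∉ A'.erase j)
                then D x y else 0).rank : ℤ) -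
             ((Matrix.of fun x y => if (rI x ∈ A.erase i ∧ rJ x ∈ A'.erase j) ∧ (cI y ∉ A.erase i ∧ cJ y ∉ A'.erase j) ∧
                  ¬ (cI y = i ∧ cJ y = j) then D x y else 0).rank : ℤ))) ≤
        3 * ∑ A : Finset X, ∑ A' : Finset Y,
          ((Matrix.of fun x y => if (rI x ∈ A ∧ rJ x ∈ A') ∧ (cI y ∉ A ∧ cJ y ∉ A') then D x y else 0).rank : ℤ) := by
  intro K _ ι ι' X Y _ _ _ _ _ _ _ _ rI rJ cI cJ D
  have ha := sum_familyI_le rI rJ cI cJ D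
  have hb := sum_familyJ_le rI rJ cI cJ D
  have hc := sum_familyIJ_le rI rJ cI cJ D
  simp only [Finset.sum_add_distrib]
  linarith

end Summit.PneNP.PneNP.Theorems.CnfIdealGenLengthRankDefectRepresentationsBandAveraging
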